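import Summits.AtomisticToContinuum.BoseEinsteinCondensation.Theses.BECRieszReverseHolder
import Summits.AtomisticToContinuum.BoseEinsteinCondensation.Theorems.BECRieszReverseHolderCoarseGrainedReverseHolderReduction
import Summits.AtomisticToContinuum.BoseEinsteinCondensation.Theorems.BECRieszReverseHolderCoarseGrainedReverseHolderGroundStateEquivalence
import Summits.AtomisticToContinuum.BoseEinsteinCondensation.Theorems.BECRieszReverseHolderCoarseGrainedReverseHolderStubSliceLipschitzOf
import Literature.MathematicalPhysics.QuantumManyBody.GroundState
import HarnessLib.Audit

/-!
# Skeleton `sharedbath` for crux `BECRieszReverseHolder.CoarseGrainedReverseHolder`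
(item stmt-AtomisticToContinuum-12840; strategist line, registered ALONGSIDE the lead's line `registered`,
planner-cstrat-stmt-AtomisticToContinuum-12840-s1-0, 2026-08-17)

IDEA (shared-bath second impurity / Doob transform in the environment). Write the crux functional of a
non-negative ground state `Φ = Φ_{n+1}` as `F = m³ ∫ A(X̂)/M(X̂) dX̂` with `A = Σ_Q (∫_Q Φ(y,X̂)² dy)²` and the
one-body marginal `M(X̂) = ∫ Φ(y,X̂)² dy` DOWNSTAIRS.  Replace the marginal `M` by the density `Φ_n(X̂)²` of a
non-negative ground state OF THE BATH ALONE (`n` bosons, same `v`, same box): `Φ_{n+1}(y,X̂)/Φ_n(X̂) =: η` is the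
impurity amplitude relative to the unperturbed bath (polaron / Doob `h`-transform), and
`M/Φ_n² = ‖η_X̂‖²_{L²(dy)}` is the INSERTION RATIO (quantum Widom factor), a box AVERAGE of a local functional
of the bath, mean `1` under `Φ_n² dX̂`.  Pointwise `A/M ≤ c⁻¹ A/Φ_n² + 1_{M < c Φ_n²} M` (use `A ≤ M²` on the
bad set), so GS-bound (hence the crux, `coarseGrainedReverseHolder_of_groundStates`) follows from

* `stub_insertionRatioLowerTail` — the bad set `{M < c Φ_n²}` has `M`-mass `≤ C/(n+1)` (lower tail of the
  insertion ratio: self-averaging of `‖η_X̂‖²` over the `(L/ξ)³` correlation volumes), and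
* `stub_sharedBathNoClumping` — `m³ ∫ A/Φ_n² ≤ C`: two impurities sharing one bath through the PRODUCT
  ansatz `Ξ = Φ_{n+1}(y,X̂) Φ_{n+1}(y',X̂)/Φ_n(X̂)` do not co-occupy an `ℓ`-cube beyond volume fraction
  (`Ξ` does not vanish at `y = y'`, so the near-diagonal replica mass — crux-equivalent for comparisons with
  the true `(n+2)`-ground state, which vanishes there for hard cores — is dominated here).

The composition `CoarseGrainedReverseHolder_of` below is sorry-free apart from the two stubs (S-B is stated
with `∃ Φ₀` — a prover takes the non-negative bath ground state of `stub_existsNonnegGroundState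
stub_compactness`, finite energy by `GroundStateEnergyFinite` + `groundStateEnergy_le_succ` — and S-A with
`∀ Φ₀`, the benign direction).  Disproof used: none exists for this crux (`ledger crux ls`, 2026-08-17).
-/

noncomputable section

open MeasureTheory Filter Matrix
open scoped ENNReal NNReal BigOperators

namespace Summit.AtomisticToContinuum.BoseEinsteinCondensation.Cruxes.CoarseGrainedReverseHolder.SharedBath

open Literature.MathematicalPhysics.QuantumManyBody
open Summit.AtomisticToContinuum.BoseEinsteinCondensation.Theses.BECRieszReverseHolder
open Summit.AtomisticToContinuum.BoseEinsteinCondensation.Theorems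
open Summit.AtomisticToContinuum.BoseEinsteinCondensation.Theorems.CoarseGrainedReverseHolder

/-! ## Stubs (`sorry` only here) -/

/-- **Insertion-ratio lower tail (stub S-A).** For admissible `v` and small `ρ` there are `c > 0` and `C`
such that, eventually in `n`, for every non-negative ground state `Φ` of `n+1` bosons and every
non-negative ground state `Φ₀` of `n` bosons in the SAME Dirichlet box of side `L = sideLength ρ (n+1)`,
the environments `X̂` where the one-body marginal `M(X̂) = ∫ Φ(y,X̂)² dy` falls below `c Φ₀(X̂)²` carry
`M`-mass at most `C/(n+1)`.  Heuristics: `M/Φ₀² = ‖η_X̂‖²` (insertion ratio, mean `1` under `Φ₀²`) is a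
volume average of `e^{-W_X̂}` over the box and concentrates at rate `(ξ/L)^{3/2}`; exact (`M = Φ₀²·const`)
for `v = 0` and for Jastrow states with compactly supported factor.  Why it might fail: large voids of the
bath make `η` large, not small — the lower tail is the benign side — but a proof needs a large-deviation
bound for a ground-state density with no Gibbs structure. -/
theorem stub_insertionRatioLowerTail :
    ∀ v : ℝ → ENNReal, BoseGas.IsRepulsiveFiniteRange v →
      ∃ ρ₀ : ℝ, 0 < ρ₀ ∧ ∀ ρ : ℝ, 0 < ρ → ρ < ρ₀ → ∃ c : ℝ, 0 < c ∧ ∃ C : ℝ,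
      ∀ᶠ n : ℕ in Filter.atTop,
        ∀ Φ : BoseGas.Config (n + 1) → ℂ,
          BoseGas.IsGroundState v (BoseGas.sideLength ρ (n + 1)) Φ → (∀ X, Φ X = (‖Φ X‖ : ℂ)) →
        ∀ Φ₀ : BoseGas.Config n → ℂ,
          BoseGas.IsGroundState v (BoseGas.sideLength ρ (n + 1)) Φ₀ → (∀ X, Φ₀ X = (‖Φ₀ X‖ : ℂ)) →
          ∫⁻ X in {X : Fin n → EuclideanSpace ℝ (Fin 3) |
              (∫⁻ y, (‖Φ (Matrix.vecCons y X)‖₊ : ENNReal) ^ 2) <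
                ENNReal.ofReal c * (‖Φ₀ X‖₊ : ENNReal) ^ 2},
            (∫⁻ y, (‖Φ (Matrix.vecCons y X)‖₊ : ENNReal) ^ 2)
            ≤ ENNReal.ofReal (C / (n + 1)) := by
  sorry

/-- **Shared-bath no-clumping (stub S-B, HARDEST).** For admissible `v`, small `ρ` and every `ℓ > 0` there
is `C` such that, eventually in `n`, for every non-negative ground state `Φ` of `n+1` bosons there is a
non-negative ground state `Φ₀` of `n` bosons in the same box of side `L = sideLength ρ (n+1)` such that
(`m = ⌊L/ℓ⌋₊`, cubes `Q_k = ∏ᵢ [kᵢ L/m, (kᵢ+1) L/m)`):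
`m³ ∫ dX̂ Σ_k (∫_{Q_k} Φ(y,X̂)² dy)² / Φ₀(X̂)² ≤ C` — the two-replica coincidence functional with the BATH
ground-state density downstairs, i.e. `m³ · ∫ 1(y ∼ y') Ξ²` for the product-ansatz two-impurity function
`Ξ = Φ(y,X̂)Φ(y',X̂)/Φ₀(X̂)`.  Heuristics: `= m³ Σ_Q (∫_Q φ₀²)² ≤ 8` at `v = 0`; in Bogoliubov/Jastrow theory
`Ξ` is the two-polaron state without direct interaction and the bath-induced attraction is subcritical in
`d = 3` (`a/ξ = √(8πρa³) → 0`), so no co-localisation.  Why it might fail: `1/Φ₀²` is unbounded on bath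
voids where `η = Φ/Φ₀` is enhanced (`e^{+cR/ξ}` for a void of radius `R`); the bound needs the void
statistics of `Φ₀²` to beat that gain (annealed, it does: cost superlinear in `R`). -/
theorem stub_sharedBathNoClumping :
    ∀ v : ℝ → ENNReal, BoseGas.IsRepulsiveFiniteRange v →
      ∃ ρ₀ : ℝ, 0 < ρ₀ ∧ ∀ ρ : ℝ, 0 < ρ → ρ < ρ₀ → ∀ ℓ : ℝ, 0 < ℓ → ∃ C : ℝ,
      ∀ᶠ n : ℕ in Filter.atTop,
        ∀ Φ : BoseGas.Config (n + 1) → ℂ,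
          BoseGas.IsGroundState v (BoseGas.sideLength ρ (n + 1)) Φ → (∀ X, Φ X = (‖Φ X‖ : ℂ)) →
        ∃ Φ₀ : BoseGas.Config n → ℂ,
          BoseGas.IsGroundState v (BoseGas.sideLength ρ (n + 1)) Φ₀ ∧ (∀ X, Φ₀ X = (‖Φ₀ X‖ : ℂ)) ∧
          (⌊BoseGas.sideLength ρ (n + 1) / ℓ⌋₊ : ENNReal) ^ 3 *
              ∫⁻ X : Fin n → EuclideanSpace ℝ (Fin 3),
                ((∑ k : Fin 3 → Fin ⌊BoseGas.sideLength ρ (n + 1) / ℓ⌋₊,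
                    (∫⁻ y in {y : EuclideanSpace ℝ (Fin 3) | ∀ i, y i ∈
                        Set.Ico ((k i : ℝ) * (BoseGas.sideLength ρ (n + 1) /
                            ⌊BoseGas.sideLength ρ (n + 1) / ℓ⌋₊))
                          (((k i : ℝ) + 1) * (BoseGas.sideLength ρ (n + 1) /
                            ⌊BoseGas.sideLength ρ (n + 1) / ℓ⌋₊))},
                      (‖Φ (Matrix.vecCons y X)‖₊ : ENNReal) ^ 2) ^ 2) /
                  ((‖Φ₀ X‖₊ : ENNReal) ^ 2))
            ≤ ENNReal.ofReal C := by
  sorry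

/-! ## Toolkit for the composition (sorry-free) -/

/-- `Σ a_k² ≤ (Σ a_k)²` in `ℝ≥0∞`. -/
theorem sum_sq_le_sq_sum {ι : Type*} [Fintype ι] (a : ι → ℝ≥0∞) :
    ∑ k, a k ^ 2 ≤ (∑ k, a k) ^ 2 := by
  calc ∑ k, a k ^ 2 ≤ ∑ k, a k * ∑ j, a j := by
        refine Finset.sum_le_sum fun k _ => ?_
        rw [sq]
        exact mul_le_mul_right (Finset.single_le_sum (fun j _ => zero_le) (Finset.mem_univ k)) _
    _ = (∑ k, a k) ^ 2 := by rw [← Finset.sum_mul, sq]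

/-- **The pointwise splitting.** If `A ≤ M²` and `0 < c < ⊤` then
`A/M ≤ c⁻¹ (A/D) + 1_{M < c D} M`. -/
theorem div_le_inv_mul_div_add_indicator {α : Type*} {A M D : α → ℝ≥0∞} {x : α}
    (hA : A x ≤ M x ^ 2) {c : ℝ≥0∞} (hc0 : c ≠ 0) (hct : c ≠ ⊤) :
    A x / M x ≤ c⁻¹ * (A x / D x) + {x | M x < c * D x}.indicator M x := by
  by_cases h : c * D x ≤ M x
  · have h1 : A x / M x ≤ A x / (c * D x) := ENNReal.div_le_div_left h (A x)
    have h2 : A x / (c * D x) = c⁻¹ * (A x / D x) := by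
      rw [div_eq_mul_inv, div_eq_mul_inv, ENNReal.mul_inv (Or.inl hc0) (Or.inl hct)]
      ring
    exact h1.trans (h2.le.trans le_self_add)
  · have hlt : M x < c * D x := not_le.mp h
    rw [Set.indicator_of_mem (show x ∈ {x | M x < c * D x} from hlt)]
    have h3 : A x / M x ≤ M x := ENNReal.div_le_of_le_mul (by rwa [← sq])
    exact h3.trans le_add_self

/-- **The integrated splitting.** For measurable `M, D` with `A ≤ M²` pointwise and `0 < c < ⊤`:
`∫ A/M ≤ c⁻¹ ∫ A/D + ∫_{M < cD} M`. -/
theorem lintegral_div_le_split {α : Type*} [MeasurableSpace α] {μ : Measure α} {A M D : α → ℝ≥0∞}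
    (hM : Measurable M) (hD : Measurable D) (hA : ∀ x, A x ≤ M x ^ 2) {c : ℝ≥0∞} (hc0 : c ≠ 0)
    (hct : c ≠ ⊤) :
    ∫⁻ x, A x / M x ∂μ ≤ c⁻¹ * ∫⁻ x, A x / D x ∂μ + ∫⁻ x in {x | M x < c * D x}, M x ∂μ := by
  have hbad : MeasurableSet {x | M x < c * D x} := measurableSet_lt hM (hD.const_mul c)
  calc ∫⁻ x, A x / M x ∂μ
      ≤ ∫⁻ x, (c⁻¹ * (A x / D x) + {x | M x < c * D x}.indicator M x) ∂μ := by
        exact lintegral_mono fun x => div_le_inv_mul_div_add_indicator (hA x) hc0 hct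
    _ = ∫⁻ x, c⁻¹ * (A x / D x) ∂μ + ∫⁻ x, {x | M x < c * D x}.indicator M x ∂μ :=
        lintegral_add_right _ (hM.indicator hbad)
    _ = c⁻¹ * ∫⁻ x, A x / D x ∂μ + ∫⁻ x in {x | M x < c * D x}, M x ∂μ := by
        rw [lintegral_const_mul' _ _ (ENNReal.inv_ne_top.mpr hc0), lintegral_indicator hbad]

/-- `A(X̂) = Σ_k (∫_{Q_k} |Φ(y,X̂)|²)² ≤ M(X̂)² = (∫ |Φ(y,X̂)|²)²` for the congruent cubes of the crux. -/
theorem sum_sq_setLIntegral_cubes_le {n : ℕ} {Φ : BoseGas.Config (n + 1) → ℂ} (hΦ : Measurable Φ)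
    (L : ℝ) (m : ℕ) (X : BoseGas.Config n) :
    (∑ k : Fin 3 → Fin m,
        (∫⁻ y in {y : EuclideanSpace ℝ (Fin 3) | ∀ i, y i ∈
            Set.Ico ((k i : ℝ) * (L / m)) (((k i : ℝ) + 1) * (L / m))},
          (‖Φ (Matrix.vecCons y X)‖₊ : ENNReal) ^ 2) ^ 2) ≤
      (∫⁻ y, (‖Φ (Matrix.vecCons y X)‖₊ : ENNReal) ^ 2) ^ 2 := by
  have hw : Measurable fun y : BoseGas.Space => (‖Φ (Matrix.vecCons y X)‖₊ : ENNReal) ^ 2 :=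
    ((BoseGas.measurable_comp_vecCons_left hΦ X).nnnorm.coe_nnreal_ennreal.pow_const 2)
  refine (sum_sq_le_sq_sum _).trans ?_
  gcongr
  simp_rw [CoarseRH2.setOf_forall_mem_Ico_eq_subCell L m]
  exact SliceLipschitz.sum_setLIntegral_subCell_le_any (L / m) hw.aemeasurable

/-! ## Composition (sorry-free; concludes the crux BY NAME) -/

/-- **GS-bound from the two stubs.**  For each large `n` and each non-negative ground state `Φ`, stub S-B
supplies a non-negative bath ground state `Φ₀` of `n` bosons in the box of side `sideLength ρ (n+1)` with
the shared-bath bound; the integrated splitting with `D = Φ₀²` and stub S-A (applied to this `Φ₀`) give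
`m³ ∫ A/M ≤ c⁻¹ C_B + m³ C_A/(n+1) ≤ c⁻¹ C_B + C_A/(ρ ℓ³)` since `m³ ≤ (L/ℓ)³ = (n+1)/(ρℓ³)`. -/
theorem gsBound_of_stubs
    (hA : ∀ v : ℝ → ENNReal, BoseGas.IsRepulsiveFiniteRange v →
      ∃ ρ₀ : ℝ, 0 < ρ₀ ∧ ∀ ρ : ℝ, 0 < ρ → ρ < ρ₀ → ∃ c : ℝ, 0 < c ∧ ∃ C : ℝ,
      ∀ᶠ n : ℕ in Filter.atTop,
        ∀ Φ : BoseGas.Config (n + 1) → ℂ,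
          BoseGas.IsGroundState v (BoseGas.sideLength ρ (n + 1)) Φ → (∀ X, Φ X = (‖Φ X‖ : ℂ)) →
        ∀ Φ₀ : BoseGas.Config n → ℂ,
          BoseGas.IsGroundState v (BoseGas.sideLength ρ (n + 1)) Φ₀ → (∀ X, Φ₀ X = (‖Φ₀ X‖ : ℂ)) →
          ∫⁻ X in {X : Fin n → EuclideanSpace ℝ (Fin 3) |
              (∫⁻ y, (‖Φ (Matrix.vecCons y X)‖₊ : ENNReal) ^ 2) <
                ENNReal.ofReal c * (‖Φ₀ X‖₊ : ENNReal) ^ 2},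
            (∫⁻ y, (‖Φ (Matrix.vecCons y X)‖₊ : ENNReal) ^ 2)
            ≤ ENNReal.ofReal (C / (n + 1)))
    (hB : ∀ v : ℝ → ENNReal, BoseGas.IsRepulsiveFiniteRange v →
      ∃ ρ₀ : ℝ, 0 < ρ₀ ∧ ∀ ρ : ℝ, 0 < ρ → ρ < ρ₀ → ∀ ℓ : ℝ, 0 < ℓ → ∃ C : ℝ,
      ∀ᶠ n : ℕ in Filter.atTop,
        ∀ Φ : BoseGas.Config (n + 1) → ℂ,
          BoseGas.IsGroundState v (BoseGas.sideLength ρ (n + 1)) Φ → (∀ X, Φ X = (‖Φ X‖ : ℂ)) →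
        ∃ Φ₀ : BoseGas.Config n → ℂ,
          BoseGas.IsGroundState v (BoseGas.sideLength ρ (n + 1)) Φ₀ ∧ (∀ X, Φ₀ X = (‖Φ₀ X‖ : ℂ)) ∧
          (⌊BoseGas.sideLength ρ (n + 1) / ℓ⌋₊ : ENNReal) ^ 3 *
              ∫⁻ X : Fin n → EuclideanSpace ℝ (Fin 3),
                ((∑ k : Fin 3 → Fin ⌊BoseGas.sideLength ρ (n + 1) / ℓ⌋₊,
                    (∫⁻ y in {y : EuclideanSpace ℝ (Fin 3) | ∀ i, y i ∈
                        Set.Ico ((k i : ℝ) * (BoseGas.sideLength ρ (n + 1) /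
                            ⌊BoseGas.sideLength ρ (n + 1) / ℓ⌋₊))
                          (((k i : ℝ) + 1) * (BoseGas.sideLength ρ (n + 1) /
                            ⌊BoseGas.sideLength ρ (n + 1) / ℓ⌋₊))},
                      (‖Φ (Matrix.vecCons y X)‖₊ : ENNReal) ^ 2) ^ 2) /
                  ((‖Φ₀ X‖₊ : ENNReal) ^ 2))
            ≤ ENNReal.ofReal C) :
    ∀ v : ℝ → ENNReal, BoseGas.IsRepulsiveFiniteRange v →
      ∃ ρ₀ : ℝ, 0 < ρ₀ ∧ ∀ ρ : ℝ, 0 < ρ → ρ < ρ₀ → ∀ ℓ : ℝ, 0 < ℓ → ∃ C : ℝ,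
      ∀ᶠ n : ℕ in Filter.atTop,
        ∀ Φ : BoseGas.Config (n + 1) → ℂ,
          BoseGas.IsGroundState v (BoseGas.sideLength ρ (n + 1)) Φ → (∀ X, Φ X = (‖Φ X‖ : ℂ)) →
          (⌊BoseGas.sideLength ρ (n + 1) / ℓ⌋₊ : ENNReal) ^ 3 *
              ∫⁻ X : Fin n → EuclideanSpace ℝ (Fin 3),
                ((∑ k : Fin 3 → Fin ⌊BoseGas.sideLength ρ (n + 1) / ℓ⌋₊,
                    (∫⁻ y in {y : EuclideanSpace ℝ (Fin 3) | ∀ i, y i ∈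
                        Set.Ico ((k i : ℝ) * (BoseGas.sideLength ρ (n + 1) /
                            ⌊BoseGas.sideLength ρ (n + 1) / ℓ⌋₊))
                          (((k i : ℝ) + 1) * (BoseGas.sideLength ρ (n + 1) /
                            ⌊BoseGas.sideLength ρ (n + 1) / ℓ⌋₊))},
                      (‖Φ (Matrix.vecCons y X)‖₊ : ENNReal) ^ 2) ^ 2) /
                  (∫⁻ y, (‖Φ (Matrix.vecCons y X)‖₊ : ENNReal) ^ 2))
            ≤ ENNReal.ofReal C := by
  intro v hv
  obtain ⟨ρ₁, hρ₁, h1⟩ := hA v hv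
  obtain ⟨ρ₂, hρ₂, h2⟩ := hB v hv
  refine ⟨min ρ₁ ρ₂, lt_min hρ₁ hρ₂, fun ρ hρ hρlt ℓ hℓ => ?_⟩
  have hρ₁' : ρ < ρ₁ := hρlt.trans_le (min_le_left _ _)
  have hρ₂' : ρ < ρ₂ := hρlt.trans_le (min_le_right _ _)
  obtain ⟨c, hc, CA, hCA⟩ := h1 ρ hρ hρ₁'
  obtain ⟨CB, hCB⟩ := h2 ρ hρ hρ₂' ℓ hℓ
  refine ⟨c⁻¹ * max CB 0 + max CA 0 / (ρ * ℓ ^ 3), ?_⟩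
  filter_upwards [hCA, hCB] with n hAn hBn
  intro Φ hΦgs hΦpos
  -- abbreviations
  set L : ℝ := BoseGas.sideLength ρ (n + 1) with hLdef
  set m : ℕ := ⌊L / ℓ⌋₊ with hmdef
  -- the bath ground state supplied by stub S-B, fed to stub S-A
  obtain ⟨Φ₀, hgs₀, hΦ₀pos, HB⟩ := hBn Φ hΦgs hΦpos
  have HA := hAn Φ hΦgs hΦpos Φ₀ hgs₀ hΦ₀pos
  -- measurability of `M` and `D`
  have hMm : Measurable fun X : BoseGas.Config n =>
      ∫⁻ y, (‖Φ (Matrix.vecCons y X)‖₊ : ENNReal) ^ 2 :=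
    ((hΦgs.measurable.nnnorm.coe_nnreal_ennreal.pow_const 2).comp
      BoseGas.measurable_vecCons).lintegral_prod_left'
  have hDm : Measurable fun X : BoseGas.Config n => (‖Φ₀ X‖₊ : ENNReal) ^ 2 :=
    hgs₀.measurable.nnnorm.coe_nnreal_ennreal.pow_const 2
  have hc0 : ENNReal.ofReal c ≠ 0 := (ENNReal.ofReal_pos.mpr hc).ne'
  have hct : ENNReal.ofReal c ≠ ⊤ := ENNReal.ofReal_ne_top
  -- the integrated splitting
  have hsplit := lintegral_div_le_split (μ := volume)
    (A := fun X : BoseGas.Config n => ∑ k : Fin 3 → Fin m,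
        (∫⁻ y in {y : EuclideanSpace ℝ (Fin 3) | ∀ i, y i ∈
            Set.Ico ((k i : ℝ) * (L / m)) (((k i : ℝ) + 1) * (L / m))},
          (‖Φ (Matrix.vecCons y X)‖₊ : ENNReal) ^ 2) ^ 2)
    hMm hDm (fun X => sum_sq_setLIntegral_cubes_le hΦgs.measurable L m X) hc0 hct
  -- numerical bookkeeping
  have hm_le : ((m : ℕ) : ℝ) ^ 3 ≤ (n + 1) / (ρ * ℓ ^ 3) := by
    have hL0 : 0 ≤ L := BoseGas.sideLength_nonneg hρ.le (n + 1)
    have hfl : (m : ℝ) ≤ L / ℓ := Nat.floor_le (div_nonneg hL0 hℓ.le)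
    have hL3 : L ^ 3 = (n + 1 : ℝ) / ρ := by
      rw [hLdef, BoseGas.sideLength_pow_three hρ (n + 1), Nat.cast_add, Nat.cast_one]
    calc ((m : ℕ) : ℝ) ^ 3 ≤ (L / ℓ) ^ 3 := by gcongr
      _ = (n + 1) / (ρ * ℓ ^ 3) := by rw [div_pow, hL3, div_div]
  have hkey1 : (m : ENNReal) ^ 3 * ENNReal.ofReal (CA / (n + 1)) ≤
      ENNReal.ofReal (max CA 0 / (ρ * ℓ ^ 3)) := by
    have hn1 : (0 : ℝ) < n + 1 := by positivity
    rw [← ENNReal.ofReal_natCast, ← ENNReal.ofReal_pow (Nat.cast_nonneg _),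
      ← ENNReal.ofReal_mul (by positivity)]
    refine ENNReal.ofReal_le_ofReal ?_
    calc ((m : ℕ) : ℝ) ^ 3 * (CA / (n + 1)) ≤ ((m : ℕ) : ℝ) ^ 3 * (max CA 0 / (n + 1)) := by
          gcongr; exact le_max_left _ _
      _ ≤ (n + 1) / (ρ * ℓ ^ 3) * (max CA 0 / (n + 1)) := by gcongr
      _ = max CA 0 / (ρ * ℓ ^ 3) := by
          rw [div_mul_div_comm, mul_comm ((n : ℝ) + 1) (max CA 0), mul_div_mul_right _ _ hn1.ne']
  have hkey2 : (ENNReal.ofReal c)⁻¹ * ENNReal.ofReal CB ≤ ENNReal.ofReal (c⁻¹ * max CB 0) := by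
    rw [← ENNReal.ofReal_inv_of_pos hc, ← ENNReal.ofReal_mul (inv_nonneg.mpr hc.le)]
    exact ENNReal.ofReal_le_ofReal (by gcongr; exact le_max_left _ _)
  have hnonneg1 : 0 ≤ c⁻¹ * max CB 0 := mul_nonneg (inv_nonneg.mpr hc.le) (le_max_right _ _)
  have hnonneg2 : 0 ≤ max CA 0 / (ρ * ℓ ^ 3) := by positivity
  calc (m : ENNReal) ^ 3 * ∫⁻ X : Fin n → EuclideanSpace ℝ (Fin 3),
          (∑ k : Fin 3 → Fin m,
              (∫⁻ y in {y : EuclideanSpace ℝ (Fin 3) | ∀ i, y i ∈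
                  Set.Ico ((k i : ℝ) * (L / m)) (((k i : ℝ) + 1) * (L / m))},
                (‖Φ (Matrix.vecCons y X)‖₊ : ENNReal) ^ 2) ^ 2) /
            (∫⁻ y, (‖Φ (Matrix.vecCons y X)‖₊ : ENNReal) ^ 2)
      ≤ (m : ENNReal) ^ 3 * ((ENNReal.ofReal c)⁻¹ * (∫⁻ X : Fin n → EuclideanSpace ℝ (Fin 3),
          (∑ k : Fin 3 → Fin m,
              (∫⁻ y in {y : EuclideanSpace ℝ (Fin 3) | ∀ i, y i ∈
                  Set.Ico ((k i : ℝ) * (L / m)) (((k i : ℝ) + 1) * (L / m))},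
                (‖Φ (Matrix.vecCons y X)‖₊ : ENNReal) ^ 2) ^ 2) / ((‖Φ₀ X‖₊ : ENNReal) ^ 2)) +
          ∫⁻ X in {X : Fin n → EuclideanSpace ℝ (Fin 3) |
              (∫⁻ y, (‖Φ (Matrix.vecCons y X)‖₊ : ENNReal) ^ 2) <
                ENNReal.ofReal c * (‖Φ₀ X‖₊ : ENNReal) ^ 2},
            (∫⁻ y, (‖Φ (Matrix.vecCons y X)‖₊ : ENNReal) ^ 2)) :=
        mul_le_mul_right hsplit _
    _ = (ENNReal.ofReal c)⁻¹ * ((m : ENNReal) ^ 3 * (∫⁻ X : Fin n → EuclideanSpace ℝ (Fin 3),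
          (∑ k : Fin 3 → Fin m,
              (∫⁻ y in {y : EuclideanSpace ℝ (Fin 3) | ∀ i, y i ∈
                  Set.Ico ((k i : ℝ) * (L / m)) (((k i : ℝ) + 1) * (L / m))},
                (‖Φ (Matrix.vecCons y X)‖₊ : ENNReal) ^ 2) ^ 2) / ((‖Φ₀ X‖₊ : ENNReal) ^ 2))) +
          (m : ENNReal) ^ 3 * ∫⁻ X in {X : Fin n → EuclideanSpace ℝ (Fin 3) |
              (∫⁻ y, (‖Φ (Matrix.vecCons y X)‖₊ : ENNReal) ^ 2) <
                ENNReal.ofReal c * (‖Φ₀ X‖₊ : ENNReal) ^ 2},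
            (∫⁻ y, (‖Φ (Matrix.vecCons y X)‖₊ : ENNReal) ^ 2) := by
        ring
    _ ≤ (ENNReal.ofReal c)⁻¹ * ENNReal.ofReal CB +
          (m : ENNReal) ^ 3 * ENNReal.ofReal (CA / (n + 1)) :=
        add_le_add (mul_le_mul_right HB _) (mul_le_mul_right HA _)
    _ ≤ ENNReal.ofReal (c⁻¹ * max CB 0) + ENNReal.ofReal (max CA 0 / (ρ * ℓ ^ 3)) :=
        add_le_add hkey2 hkey1
    _ = ENNReal.ofReal (c⁻¹ * max CB 0 + max CA 0 / (ρ * ℓ ^ 3)) :=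
        (ENNReal.ofReal_add hnonneg1 hnonneg2).symm

/-- **Strategist skeleton theorem** — `CoarseGrainedReverseHolder` from the two stubs through the landed
reduction to non-negative ground states. -/
theorem CoarseGrainedReverseHolder_of : CoarseGrainedReverseHolder :=
  coarseGrainedReverseHolder_of_groundStates
    (gsBound_of_stubs stub_insertionRatioLowerTail stub_sharedBathNoClumping)

end Summit.AtomisticToContinuum.BoseEinsteinCondensation.Cruxes.CoarseGrainedReverseHolder.SharedBath

end
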